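import Summits.QuantumFields.YangMills.Theorems.F4SubCurvatureDoorShortRootRigidityConePackaging
import Mathlib
import HarnessLib

/-!
# The COMPLEX planar Laplace–Fourier tube function of a measure carried by the forward light cone

Free-hands work of width seat `ym-line-sfw-p2-w3` (g39, cell `ym-idea-1`) toward rung **R2 `HermitianAngularRung`** of the insurance
sub-line g22-A «Hermitian slice» (`Cruxes/ShortRootRigidity/Lines/hermitian_slice_rungs.lean`, owner ym-idea-3 g22) for the registered stub
`:146 stub_oddModeRigidity` of crux ⟨stmt-QuantumFields-23035⟩ `F4SubCurvatureDoor.ShortRootRigidity`.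

For a measure `μ` on `(E, p) ∈ ℝ × ℝ` with APERTURE `1` (`μ{E < |p|} = 0`) and `e^{−tE} ∈ L¹(μ)` for every `t > 0` (the two conjuncts a
Hermitian planar Laplace–Fourier measure has after rung R1), the complex tube function
`F(ζ, β) = ∫ e^{−ζE} e^{iβp} dμ(E, p)` is

* holomorphic on the forward tube `fwdTube = {|Im β| < Re ζ}` (dominated holomorphic parameter integral,
  ✓`Literature.Analysis.Complex.differentiableOn_integral_of_dominated`; near `(ζ₀, β₀)` the dominator is `e^{−2R·E}` with
  `4R = Re ζ₀ − |Im β₀|`),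
* has the REAL TRACE `F(t, x) = ∫ e^{−tE} e^{ixp} dμ` (`t > 0`) — literally the integrand of `IsHermitianPlanarLF`, and
* obeys the CONE MAJORANT `‖F(ζ, β)‖ ≤ ∫ e^{−(Re ζ − |Im β|)E} dμ` (`|e^{−ζE}e^{iβp}| = e^{−Re ζ·E − Im β·p} ≤ e^{−(Re ζ − |Im β|)E}` for `|p| ≤ E`).

This is the sibling, for the COMPLEX kernel `e^{iβp}` and without the `ε`-shift, of ✓`stub_planarSpectralCone_of_coneSupport`
(`Theorems/F4SubCurvatureDoorShortRootRigidityConePackaging.lean`, real kernel `cos(βp)`).  Stated as an existence package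
(`exists_hermitianTubeFunction`) so that no definition is introduced.  Mathlib + tree only; no `sorry`.

HONEST LABEL: measure-theoretic plumbing for ONE rung (R2, M) of an unregistered INSURANCE sub-line; R1–R4, H1–H4, `:146`, ⟨23035⟩,
⟨23125⟩, R2d and the Yang–Mills mass gap are OPEN; no summit is proved by a line.
-/

noncomputable section

namespace Summit.QuantumFields.YangMills.Theorems.F4SubCurvatureDoorHermitianTube

open MeasureTheory Filter Topology Set Metric Complex
open scoped BigOperators NNReal ENNReal
open Summit.QuantumFields.YangMills.Cruxes.ShortRootRigidity.AngularType (fwdTube)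
open Summit.QuantumFields.YangMills.Cruxes.ShortRootRigidity.AngularType.AngularChartA (isOpen_fwdTube)

/-! ## Pointwise bounds for the complex kernel `e^{−ζE} e^{iβp}` -/

/-- The modulus of the complex kernel: `‖e^{−ζE} e^{iβp}‖ = e^{−Re ζ·E − Im β·p}`. -/
theorem norm_hKer (ζ β : ℂ) (E p : ℝ) :
    ‖Complex.exp (-(ζ * (E : ℂ))) * Complex.exp (β * (p : ℂ) * Complex.I)‖ = Real.exp (-(ζ.re * E) + -(β.im * p)) := by
  rw [norm_mul, Complex.norm_exp, Complex.norm_exp, ← Real.exp_add]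
  congr 1
  simp [Complex.mul_re, Complex.mul_im]

/-- The cone majorant of the complex kernel: for `|p| ≤ E`, `‖e^{−ζE} e^{iβp}‖ ≤ e^{−(Re ζ − |Im β|)E}`. -/
theorem norm_hKer_le_cone {ζ β : ℂ} {E p : ℝ} (hp : |p| ≤ E) :
    ‖Complex.exp (-(ζ * (E : ℂ))) * Complex.exp (β * (p : ℂ) * Complex.I)‖ ≤ Real.exp (-((ζ.re - |β.im|) * E)) := by
  rw [norm_hKer]
  refine Real.exp_le_exp.2 ?_
  have h : -(β.im * p) ≤ |β.im| * E :=
    calc -(β.im * p) ≤ |β.im * p| := neg_le_abs _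
      _ = |β.im| * |p| := abs_mul _ _
      _ ≤ |β.im| * E := mul_le_mul_of_nonneg_left hp (abs_nonneg _)
  nlinarith

/-- The domination form: for `E ≥ 0`, `|p| ≤ E`, `t₁ ≤ Re ζ` and `|Im β| ≤ β₁`, `‖e^{−ζE} e^{iβp}‖ ≤ e^{−(t₁ − β₁)E}`. -/
theorem norm_hKer_le_of_le {ζ β : ℂ} {t₁ β₁ E p : ℝ} (hE : 0 ≤ E) (hp : |p| ≤ E) (hζ : t₁ ≤ ζ.re) (hβ : |β.im| ≤ β₁) :
    ‖Complex.exp (-(ζ * (E : ℂ))) * Complex.exp (β * (p : ℂ) * Complex.I)‖ ≤ Real.exp (-((t₁ - β₁) * E)) := by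
  refine (norm_hKer_le_cone hp).trans (Real.exp_le_exp.2 ?_)
  nlinarith

/-- Under aperture `1` the measure is carried by `{|p| ≤ E}` (the support set written as in `HasAperture μ 1`). -/
theorem ae_abs_le_of_aperture_one {μ : Measure (ℝ × ℝ)} (h : μ {z : ℝ × ℝ | z.1 < 1 * |z.2|} = 0) :
    ∀ᵐ z ∂μ, |z.2| ≤ z.1 := by
  rw [ae_iff]
  have : {z : ℝ × ℝ | ¬ |z.2| ≤ z.1} = {z : ℝ × ℝ | z.1 < 1 * |z.2|} := by
    ext z; simp [not_le]
  rw [this]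
  exact h

/-- The real trace of the complex kernel, in the letters of `IsHermitianPlanarLF`:
`e^{−tE} e^{ixp} = ↑(e^{−Et}) · e^{↑(px)·i}`. -/
theorem hKer_ofReal (t x E p : ℝ) :
    Complex.exp (-((t : ℂ) * (E : ℂ))) * Complex.exp ((x : ℂ) * (p : ℂ) * Complex.I)
      = ((Real.exp (-(E * t)) : ℝ) : ℂ) * Complex.exp (((p * x : ℝ) : ℂ) * Complex.I) := by
  rw [Complex.ofReal_exp]
  push_cast
  ring_nf

/-! ## The tube function -/

/-- **The complex tube function of a cone-supported planar measure.**  For a measure `μ` on `ℝ × ℝ` with `μ{E < |p|} = 0` and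
`e^{−tE} ∈ L¹(μ)` for all `t > 0` there is `F : ℂ × ℂ → ℂ` (namely `F(ζ, β) = ∫ e^{−ζE}e^{iβp} dμ`), holomorphic on the forward tube
`{|Im β| < Re ζ}`, with real trace `F(t, x) = ∫ e^{−tE} e^{ixp} dμ` for `t > 0` and the cone majorant
`‖F(ζ, β)‖ ≤ ∫ e^{−(Re ζ − |Im β|)E} dμ`. [folklore] -/
theorem exists_hermitianTubeFunction (μ : Measure (ℝ × ℝ))
    (hInt : ∀ t : ℝ, 0 < t → Integrable (fun z : ℝ × ℝ => Real.exp (-(t * z.1))) μ)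
    (hap : μ {z : ℝ × ℝ | z.1 < 1 * |z.2|} = 0) :
    ∃ F : ℂ × ℂ → ℂ, DifferentiableOn ℂ F fwdTube ∧
      (∀ t x : ℝ, 0 < t →
        F ((t : ℂ), (x : ℂ)) = ∫ z : ℝ × ℝ, ((Real.exp (-(z.1 * t)) : ℝ) : ℂ) * Complex.exp (((z.2 * x : ℝ) : ℂ) * Complex.I) ∂μ) ∧
      ∀ w ∈ fwdTube, ‖F w‖ ≤ ∫ z : ℝ × ℝ, Real.exp (-((w.1.re - |w.2.im|) * z.1)) ∂μ := by
  have haeC : ∀ᵐ z ∂μ, |z.2| ≤ z.1 := ae_abs_le_of_aperture_one hap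
  have hae0 : ∀ᵐ z ∂μ, 0 ≤ z.1 := by
    filter_upwards [haeC] with z hz using (abs_nonneg _).trans hz
  -- the kernel and its regularity
  have hKc : ∀ q : ℂ × ℂ, Continuous fun z : ℝ × ℝ =>
      Complex.exp (-(q.1 * (z.1 : ℂ))) * Complex.exp (q.2 * (z.2 : ℂ) * Complex.I) := fun q => by fun_prop
  have hKd : ∀ z : ℝ × ℝ, Differentiable ℂ fun q : ℂ × ℂ =>
      Complex.exp (-(q.1 * (z.1 : ℂ))) * Complex.exp (q.2 * (z.2 : ℂ) * Complex.I) := fun z => by fun_prop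
  refine ⟨fun q => ∫ z : ℝ × ℝ, Complex.exp (-(q.1 * (z.1 : ℂ))) * Complex.exp (q.2 * (z.2 : ℂ) * Complex.I) ∂μ, ?_, ?_, ?_⟩
  · -- holomorphy on the forward tube
    refine Literature.Analysis.Complex.differentiableOn_integral_of_dominated (fun q _ => (hKc q).aestronglyMeasurable)
      (Eventually.of_forall fun z => (hKd z).differentiableOn) ?_
    intro q₀ hq₀
    have hq₀' : |q₀.2.im| < q₀.1.re := hq₀
    set R : ℝ := (q₀.1.re - |q₀.2.im|) / 4 with hR
    have hRpos : 0 < R := by rw [hR]; linarith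
    have hbasic : ∀ q : ℂ × ℂ, q ∈ ball q₀ R → q₀.1.re - R < q.1.re ∧ |q.2.im| < |q₀.2.im| + R := by
      intro q hq
      rw [mem_ball, Prod.dist_eq, max_lt_iff] at hq
      have h1 : |q.1.re - q₀.1.re| < R := lt_of_le_of_lt (by
        simpa using Complex.abs_re_le_norm (q.1 - q₀.1)) (by rw [← dist_eq_norm]; exact hq.1)
      have h2 : |q.2.im - q₀.2.im| < R := lt_of_le_of_lt (by
        simpa using Complex.abs_im_le_norm (q.2 - q₀.2)) (by rw [← dist_eq_norm]; exact hq.2)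
      rw [abs_lt] at h1
      have h3 := abs_add_le (q.2.im - q₀.2.im) q₀.2.im
      rw [sub_add_cancel] at h3
      exact ⟨by linarith, by linarith⟩
    have hI := hInt (2 * R) (by linarith)
    refine ⟨R, hRpos, ?_, fun z => Real.exp (-((2 * R) * z.1)), hI, ?_⟩
    · -- the ball stays in the tube
      intro q hq
      obtain ⟨h1, h2⟩ := hbasic q hq
      show |q.2.im| < q.1.re
      linarith
    · -- domination
      filter_upwards [hae0, haeC] with z hz hzC q hq
      obtain ⟨h1, h2⟩ := hbasic q hq
      refine (norm_hKer_le_of_le hz hzC h1.le h2.le).trans (Real.exp_le_exp.2 ?_)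
      have hsum : q₀.1.re - R - (|q₀.2.im| + R) = 2 * R := by rw [hR]; ring
      rw [hsum]
  · -- real points
    intro t x _
    refine integral_congr_ae (Eventually.of_forall fun z => ?_)
    dsimp only
    rw [hKer_ofReal, mul_comm z.1 t, mul_comm z.2 x]
  · -- the cone majorant
    intro w hw
    have hw' : |w.2.im| < w.1.re := hw
    have hs : 0 < w.1.re - |w.2.im| := by linarith
    have hbound : ∀ᵐ z ∂μ, ‖Complex.exp (-(w.1 * (z.1 : ℂ))) * Complex.exp (w.2 * (z.2 : ℂ) * Complex.I)‖
        ≤ Real.exp (-((w.1.re - |w.2.im|) * z.1)) := by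
      filter_upwards [haeC] with z hzC
      exact norm_hKer_le_cone hzC
    exact norm_integral_le_of_norm_le (hInt _ hs) hbound

/-- The majorant integral IS the real trace at `(s, 0)`: `∫ e^{−sE} dμ = F(s, 0)` in the letters of `IsHermitianPlanarLF`
(`x = 0`: `e^{i·0} = 1`), as a real-part statement usable with any representation `k (mk2 s 0) = ∫ …`. -/
theorem integral_exp_neg_eq_re (μ : Measure (ℝ × ℝ)) (s : ℝ) :
    ∫ z : ℝ × ℝ, Real.exp (-(s * z.1)) ∂μ
      = (∫ z : ℝ × ℝ, ((Real.exp (-(z.1 * s)) : ℝ) : ℂ) * Complex.exp (((z.2 * 0 : ℝ) : ℂ) * Complex.I) ∂μ).re := by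
  have h : (∫ z : ℝ × ℝ, ((Real.exp (-(z.1 * s)) : ℝ) : ℂ) * Complex.exp (((z.2 * 0 : ℝ) : ℂ) * Complex.I) ∂μ)
      = ∫ z : ℝ × ℝ, ((Real.exp (-(s * z.1)) : ℝ) : ℂ) ∂μ := by
    refine integral_congr_ae (Eventually.of_forall fun z => ?_)
    dsimp only
    rw [mul_zero, Complex.ofReal_zero, zero_mul, Complex.exp_zero, mul_one, mul_comm z.1 s]
  rw [h, integral_complex_ofReal, Complex.ofReal_re]

/-- The norm form: `‖F(s, 0)‖ = ∫ e^{−sE} dμ` (the trace at `x = 0` is a nonnegative real). -/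
theorem norm_trace_zero_eq (μ : Measure (ℝ × ℝ)) (s : ℝ) :
    ‖∫ z : ℝ × ℝ, ((Real.exp (-(z.1 * s)) : ℝ) : ℂ) * Complex.exp (((z.2 * 0 : ℝ) : ℂ) * Complex.I) ∂μ‖
      = ∫ z : ℝ × ℝ, Real.exp (-(s * z.1)) ∂μ := by
  have h : (∫ z : ℝ × ℝ, ((Real.exp (-(z.1 * s)) : ℝ) : ℂ) * Complex.exp (((z.2 * 0 : ℝ) : ℂ) * Complex.I) ∂μ)
      = ∫ z : ℝ × ℝ, ((Real.exp (-(s * z.1)) : ℝ) : ℂ) ∂μ := by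
    refine integral_congr_ae (Eventually.of_forall fun z => ?_)
    dsimp only
    rw [mul_zero, Complex.ofReal_zero, zero_mul, Complex.exp_zero, mul_one, mul_comm z.1 s]
  rw [h, integral_complex_ofReal, Complex.norm_real, Real.norm_eq_abs,
    abs_of_nonneg (integral_nonneg fun z => (Real.exp_pos _).le)]

end Summit.QuantumFields.YangMills.Theorems.F4SubCurvatureDoorHermitianTube

end
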